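import Mathlib
import HarnessLib
import Summits.Langlands.Langlands.Theses.PolarisationCarving
import Literature.NumberTheory.GaloisRepresentations.GaloisRep
import Literature.NumberTheory.GaloisRepresentations.AbsGaloisGroup
import Literature.NumberTheory.GaloisRepresentations.AbsGaloisOuterConj
import Literature.NumberTheory.GaloisRepresentations.ContinuousRep
import Literature.NumberTheory.GaloisRepresentations.LabelledHodgeTateWeights
import Literature.NumberTheory.GaloisRepresentations.OrdinaryRegular
import Literature.NumberTheory.GaloisRepresentations.ToLocalRestrictField
import Literature.NumberTheory.PAdicHodge.FontaineDpst
import Literature.NumberTheory.LFunctions.ChebotarevDensity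
import Literature.FieldTheory.AlgClosed.PadicAlgClEquivComplex

/-!
# PolarisationCarvingBoxes — the BOX VOCABULARY of route `PolarisationCarving` (statement-only support module)

Support module of the decomp-langlands lens-6 lineage for `route-Langlands-PolarisationCarving` (rev 6) and its child routes
(first user: the lens-6-g13 child route `OrdinarySwitchCarving` refining GNS = `PolarisationCarving.GappedNonOrdinarySystemAutomorphy`,
stmt-Langlands-33400).  STATEMENT-ONLY: `def … : Prop`-valued PREDICATES with the Galois representation as argument (no axiom, no
instance, no notation), plus `Iff.rfl` BRIDGES certifying that the born items of the route ARE these predicates boxed by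
`PrimitiveAutomorphyWhere` — so the module is checked against the tree at every build, and child-route items can be filed BY NAME
(a layer-3 cell text inlines to > 12 000 characters, above the gate's one-line item cap; with this module an item is ~700 characters
and human-readable).

Contents (every text verbatim from the cleared nodes of record — g8 `PolarisationCarving`, g9 `WeightStringCarving`, g10
`OrdinaryCompanionCarving`, g13 `OrdinarySwitchCarving`):
* `HasSelfTwist`, `IsPinnedGeometric` (byte-identical with `LevelOneDyadic.IsPinnedGeometric` of the lens-4 support module, restated
  here to keep the import cone of this route free of the lens-4 tower), `PrimitiveAutomorphyWhere` (the twist-primitive box of clause (B));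
* g8 polarisation sandwich: `IsTotallyOddPolarisable`, `IsOfPolarisedType` (TOP), `IsOfTRCMType` (SAT), `InUnpolarisedBox`;
* g9 weight-string dial: `htAt`, `IsHTRegular`, `HasWeightString`, `InGappedBox`;
* g10 dials: `IsPotentiallyOrdinary` (ORD = the lens-1-g5 SlopeLadder clause), `InCompatibleSystem` / `IsOfSystemType` (SYS),
  and the box of GNS `InAnordinarySystemBox`;
* g13 dial: `HasOrdinaryMate`, `IsOrdinarySwitchable` (OX: some TR/CM sandwich core has an irreducible, pinned-geometric,
  potentially ordinary E-rational Frobenius mate at some prime).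
Bridges (§ Bridges): `unp_iff_box`, `cw_iff_box`, `gwo_iff_box`, `gns_iff_box`, `gnl_iff_box`, `iw_iff_box`, `pol_iff_box`, `ntc_iff_box` —
each `Iff.rfl` against the TREE decl of `PolarisationCarving`.  No new mathematics; complete proofs; axioms none beyond the
three standard ones (the bridges are `Iff.rfl`).
-/

set_option linter.dupNamespace false

noncomputable section

namespace Summit.Langlands.Langlands.Theorems.PolarisationCarvingBoxes

open scoped NumberField Classical Polynomial
open Filter IsDedekindDomain Polynomial
open Literature.NumberTheory.Automorphic Literature.NumberTheory.GaloisRepresentations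
open Literature.NumberTheory.PAdicHodge
open Summit.Langlands.Langlands.Theses

/-! ## Vocabulary of the born items of `PolarisationCarving` (g8/g9/g10 kits verbatim: helper predicates with the representation
as argument; the born route file inlines them, so every bridge in § Bridges is `Iff.rfl` against the TREE decl) -/

/-- Self-twist at Frobenius level (inlined verbatim in the born items). -/
def HasSelfTwist {K : Type} [Field K] [NumberField K] {ℓ : ℕ} [Fact ℓ.Prime] {n : ℕ}
    (ρ : FramedGaloisRep K (PadicAlgCl ℓ) n) : Prop :=
  ∃ η : FramedGaloisRep K (PadicAlgCl ℓ) 1,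
    (∃ᶠ v : HeightOneSpectrum (𝓞 K) in cofinite, ∃ a : PadicAlgCl ℓ, a ≠ 1 ∧ η.HasFrobCharpolyAt v (X - C a)) ∧
    ∀ᶠ v : HeightOneSpectrum (𝓞 K) in cofinite, ∃ (P : Polynomial (PadicAlgCl ℓ)) (a : PadicAlgCl ℓ),
      ρ.HasFrobCharpolyAt v P ∧ η.HasFrobCharpolyAt v (X - C a) ∧ P.scaleRoots a = P

/-- Pinned-geometric: unramified a.e. and de Rham above `ℓ` for Fontaine's pinned datum. -/
def IsPinnedGeometric {K : Type} [Field K] [NumberField K] {ℓ : ℕ} [Fact ℓ.Prime] {n : ℕ}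
    (ρ : FramedGaloisRep K (PadicAlgCl ℓ) n) : Prop :=
  (∀ᶠ v : HeightOneSpectrum (𝓞 K) in cofinite, ρ.IsUnramifiedAt v) ∧
    ∀ (v : HeightOneSpectrum (𝓞 K)) (hv : ((ℓ : ℕ) : 𝓞 K) ∈ v.asIdeal),
      (fontainePstAdicCompletion v ℓ hv).IsDeRhamFramed (ρ.toLocal v)

/-- Weak automorphy of every irreducible, pinned-geometric, twist-primitive ρ of rank n ≥ 2 IN THE BOX `P`. -/
def PrimitiveAutomorphyWhere
    (P : ∀ (K : Type) [Field K] [NumberField K] (ℓ : ℕ) [Fact ℓ.Prime] (n : ℕ),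
      FramedGaloisRep K (PadicAlgCl ℓ) n → Prop) : Prop :=
  ∀ (K : Type) [Field K] [NumberField K] (n : ℕ) (hcpt : isCompact_glFiniteIntegralLevel n K), 2 ≤ n →
    ∀ (ℓ : ℕ) [Fact ℓ.Prime] (ι : PadicAlgCl ℓ ≃+* ℂ) (ρ : FramedGaloisRep K (PadicAlgCl ℓ) n),
      ρ.toGaloisRep.IsIrreducible → IsPinnedGeometric ρ → ¬ HasSelfTwist ρ → P K ℓ n ρ →
        ∃ π : CuspidalAutomorphicRepData n K hcpt, π.1.IsLAlgebraic ∧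
          ∀ᶠ v : HeightOneSpectrum (𝓞 K) in cofinite, SatakeFrobCompatibleAt ι π.1 ρ v

/-! ### The g8 polarisation sandwich (TOP ⊆ SAT), verbatim — it defines the grand-parent box UNP = SAT ∧ ¬TOP -/

/-- `IsTotallyOddPolarisable r` — BLGGT §2.1 «totally odd, essentially (conjugate) self-dual», in matrices (g8 verbatim). -/
def IsTotallyOddPolarisable {K₀ : Type} [Field K₀] [NumberField K₀] {ℓ : ℕ} [Fact ℓ.Prime] {n : ℕ}
    (r : FramedGaloisRep K₀ (PadicAlgCl ℓ) n) : Prop :=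
  (NumberField.IsTotallyReal K₀ ∧
    ∃ (μ : FramedGaloisRep K₀ (PadicAlgCl ℓ) 1) (A : Matrix (Fin n) (Fin n) (PadicAlgCl ℓ)), IsUnit A.det ∧
      (∀ σ : Field.absoluteGaloisGroup K₀, (r σ).val.transpose * A * (r σ).val = FramedRep.trace μ σ • A) ∧
      ∀ (φ : K₀ →+* ℝ) (c : Field.absoluteGaloisGroup K₀), IsComplexConjugation φ c →
        A.transpose = FramedRep.trace μ c • A) ∨
  (NumberField.IsTotallyComplex K₀ ∧
    ∃ (F : Type) (_ : Field F) (_ : NumberField F) (_ : Algebra F K₀) (_ : IsGalois F K₀),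
      NumberField.IsTotallyReal F ∧ Module.finrank F K₀ = 2 ∧
      ∃ μ : FramedGaloisRep F (PadicAlgCl ℓ) 1,
        ∀ (φ : F →+* ℝ) (c : Field.absoluteGaloisGroup F), IsComplexConjugation φ c →
          FramedRep.trace μ c = -1 ∧
          ∃ B : Matrix (Fin n) (Fin n) (PadicAlgCl ℓ), IsUnit B.det ∧ B.transpose = B ∧
            ∀ σ : Field.absoluteGaloisGroup K₀,
              (r σ).val.transpose * B * (r (absGaloisOuterConj F K₀ c σ)).val =
                FramedRep.trace (μ.restrictField K₀) σ • B)

/-- `IsOfPolarisedType ρ` — the saturated polarisation dial (TOP), g8 verbatim. -/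
def IsOfPolarisedType {K : Type} [Field K] [NumberField K] {ℓ : ℕ} [Fact ℓ.Prime] {n : ℕ}
    (ρ : FramedGaloisRep K (PadicAlgCl ℓ) n) : Prop :=
  ∃ (L : Type) (_ : Field L) (_ : NumberField L) (_ : Algebra K L),
    IsGalois K L ∧ IsSolvable (L ≃ₐ[K] L) ∧
    ∃ (K₀ : Type) (_ : Field K₀) (_ : NumberField K₀) (_ : Algebra K₀ L),
      IsGalois K₀ L ∧ IsSolvable (L ≃ₐ[K₀] L) ∧
      ∃ (ρ₀ : FramedGaloisRep K₀ (PadicAlgCl ℓ) n) (χ : FramedGaloisRep L (PadicAlgCl ℓ) 1),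
        IsPinnedGeometric ρ₀ ∧ IsTotallyOddPolarisable ρ₀ ∧
        ∀ g : Field.absoluteGaloisGroup L,
          FramedRep.trace (ρ.restrictField L) g = FramedRep.trace χ g * FramedRep.trace (ρ₀.restrictField L) g

/-- `IsOfTRCMType ρ` — the outer dial (SAT), g8 verbatim: the sandwich with «K₀ totally real or CM». -/
def IsOfTRCMType {K : Type} [Field K] [NumberField K] {ℓ : ℕ} [Fact ℓ.Prime] {n : ℕ}
    (ρ : FramedGaloisRep K (PadicAlgCl ℓ) n) : Prop :=
  ∃ (L : Type) (_ : Field L) (_ : NumberField L) (_ : Algebra K L),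
    IsGalois K L ∧ IsSolvable (L ≃ₐ[K] L) ∧
    ∃ (K₀ : Type) (_ : Field K₀) (_ : NumberField K₀) (_ : Algebra K₀ L),
      IsGalois K₀ L ∧ IsSolvable (L ≃ₐ[K₀] L) ∧
      ∃ (ρ₀ : FramedGaloisRep K₀ (PadicAlgCl ℓ) n) (χ : FramedGaloisRep L (PadicAlgCl ℓ) 1),
        IsPinnedGeometric ρ₀ ∧ (NumberField.IsTotallyReal K₀ ∨ NumberField.IsCMField K₀) ∧
        ∀ g : Field.absoluteGaloisGroup L,
          FramedRep.trace (ρ.restrictField L) g = FramedRep.trace χ g * FramedRep.trace (ρ₀.restrictField L) g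

/-- UNP's predicate «¬TOP ∧ SAT» (grand-parent box). -/
def InUnpolarisedBox {K : Type} [Field K] [NumberField K] {ℓ : ℕ} [Fact ℓ.Prime] {n : ℕ}
    (ρ : FramedGaloisRep K (PadicAlgCl ℓ) n) : Prop :=
  ¬ IsOfPolarisedType ρ ∧ IsOfTRCMType ρ

/-! ### The g9 weight-string dial, verbatim — it defines the parent box GW = UNP-box ∧ REG ∧ ¬CONS -/

/-- `htAt ρ v hv τ` — the τ-labelled Hodge–Tate weights of ρ|Γ_{K_v} at `v ∣ ℓ`, through Fontaine's pinned datum. -/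
def htAt {K : Type} [Field K] [NumberField K] {ℓ : ℕ} [Fact ℓ.Prime] {n : ℕ}
    (ρ : FramedGaloisRep K (PadicAlgCl ℓ) n) (v : HeightOneSpectrum (𝓞 K)) (hv : ((ℓ : ℕ) : 𝓞 K) ∈ v.asIdeal)
    (τ : v.adicCompletion K →+* PadicAlgCl ℓ) : Multiset ℤ :=
  ρ.labelledHodgeTateWeightsAt v (fontainePstAdicCompletion v ℓ hv).algebra (fontainePstAdicCompletion v ℓ hv).𝔅 τ

/-- `IsHTRegular ρ` — no repeated labelled weight at any v ∣ ℓ and continuous label (g9 verbatim). -/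
def IsHTRegular {K : Type} [Field K] [NumberField K] {ℓ : ℕ} [Fact ℓ.Prime] {n : ℕ}
    (ρ : FramedGaloisRep K (PadicAlgCl ℓ) n) : Prop :=
  ∀ (v : HeightOneSpectrum (𝓞 K)) (hv : ((ℓ : ℕ) : 𝓞 K) ∈ v.asIdeal) (τ : v.adicCompletion K →+* PadicAlgCl ℓ),
    Continuous τ → (htAt ρ v hv τ).Nodup

/-- `HasWeightString ρ` — regular AND the barrier's interval clause at every (v, τ) (g9 verbatim). -/
def HasWeightString {K : Type} [Field K] [NumberField K] {ℓ : ℕ} [Fact ℓ.Prime] {n : ℕ}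
    (ρ : FramedGaloisRep K (PadicAlgCl ℓ) n) : Prop :=
  ∀ (v : HeightOneSpectrum (𝓞 K)) (hv : ((ℓ : ℕ) : 𝓞 K) ∈ v.asIdeal) (τ : v.adicCompletion K →+* PadicAlgCl ℓ),
    Continuous τ → (htAt ρ v hv τ).Nodup ∧
      ∀ a ∈ htAt ρ v hv τ, ∀ b ∈ htAt ρ v hv τ, ∀ c : ℤ, a ≤ c → c ≤ b → c ∈ htAt ρ v hv τ

/-- CONS ⊆ REG (g9). -/
theorem isHTRegular_of_hasWeightString {K : Type} [Field K] [NumberField K] {ℓ : ℕ} [Fact ℓ.Prime] {n : ℕ}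
    {ρ : FramedGaloisRep K (PadicAlgCl ℓ) n} (h : HasWeightString ρ) : IsHTRegular ρ :=
  fun v hv τ hτ => (h v hv τ hτ).1

/-- **The parent box of this node**: GW's predicate «UNP-box ∧ (REG ∧ ¬CONS)» (tree decl
`PolarisationCarving.GappedWeightAutomorphy`; `Cert.gw_iff_box` is `Iff.rfl`). -/
def InGappedBox {K : Type} [Field K] [NumberField K] {ℓ : ℕ} [Fact ℓ.Prime] {n : ℕ}
    (ρ : FramedGaloisRep K (PadicAlgCl ℓ) n) : Prop :=
  InUnpolarisedBox ρ ∧ (IsHTRegular ρ ∧ ¬ HasWeightString ρ)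

/-! ## DIAL 1 — ORD, the barrier's evasion (i): potentially ordinary with strictly increasing labelled weights -/

/-- **`IsPotentiallyOrdinary ρ`** — VERBATIM the lens-1-g5 SlopeLadder clause (tree items
`ResidualAvatarLadder.CoreReducibleOrdinaryAutomorphy` / `…NonOrdinaryAutomorphy`): over some finite Galois L/K with
SOLVABLE group, at every place w ∣ ℓ of L the local representation ρ|Γ_{L_w}, after conjugation by some g, is UPPER
TRIANGULAR with diagonal characters ψ₁, …, ψ_n that are de Rham with single τ-labelled Hodge–Tate weights a_i(τ),
STRICTLY INCREASING in i for every ℚ_ℓ-label τ (ordinary of regular weight in the sense of Geraghty / Thorne / ACC+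
Thm 6.1.2; two-sided = orbit-closed under solvable base change, descent and algebraic twists). -/
def IsPotentiallyOrdinary {K : Type} [Field K] [NumberField K] {ℓ : ℕ} [Fact ℓ.Prime] {n : ℕ}
    (ρ : FramedGaloisRep K (PadicAlgCl ℓ) n) : Prop :=
  ∃ (L : Type) (_ : Field L) (_ : NumberField L) (_ : Algebra K L), IsGalois K L ∧ IsSolvable (L ≃ₐ[K] L) ∧
    ∀ (w : HeightOneSpectrum (𝓞 L)) (hw : ((ℓ : ℕ) : 𝓞 L) ∈ w.asIdeal),
      letI := (fontainePstAdicCompletion w ℓ hw).algebra;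
      ∃ (g : GL (Fin n) (PadicAlgCl ℓ)) (ψ : Fin n → FramedGaloisRep (w.adicCompletion L) (PadicAlgCl ℓ) 1)
        (a : Fin n → ((w.adicCompletion L) →ₐ[ℚ_[ℓ]] PadicAlgCl ℓ) → ℤ),
        FramedRep.IsUpperTriangular (((ρ.restrictField L).toLocal w).conj g) ∧
        (∀ (σ : Field.absoluteGaloisGroup (w.adicCompletion L)) (i : Fin n),
            FramedRep.diagEntry (((ρ.restrictField L).toLocal w).conj g) i σ = (ψ i).trace σ) ∧
        (∀ i : Fin n, (fontainePstAdicCompletion w ℓ hw).IsDeRhamFramed (ψ i)) ∧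
        (∀ (i : Fin n) (τ : (w.adicCompletion L) →ₐ[ℚ_[ℓ]] PadicAlgCl ℓ),
            (fontainePstAdicCompletion w ℓ hw).𝔅.labelledHodgeTateWeights (ψ i).toGaloisRep τ.toRingHom = {a i τ}) ∧
        (∀ τ : (w.adicCompletion L) →ₐ[ℚ_[ℓ]] PadicAlgCl ℓ, StrictMono (fun i : Fin n => a i τ))

/-! ## DIAL 2 — SYS, the barrier's evasion (ii): a TR/CM avatar inside a very weakly compatible system -/

/-- **`InCompatibleSystem ρ₀`** — ρ₀ : Γ_{K₀} → GL_n(ℚ̄_ℓ) is a member of a VERY WEAKLY COMPATIBLE SYSTEM over K₀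
(Boxer–Calegari–Gee–Newton–Thorne 2023, Def. 6.1.1 = ACC+ 2018 §7.1), λ-adic typing (the idiom of the tree facts
`IsWeaklyCompatibleSystemRat`, `IsWeaklyCompatibleFamily`): a number field of coefficients E (abstract, with an
embedding e into ℚ̄_ℓ through which every embedding of K₀ factors), a finite exceptional set S of places, Frobenius
polynomials Q_v ∈ E[X] (v ∉ S) read by ρ₀ at v ∤ ℓ through e, ONE labelled weight table H (indexed by K₀ ↪ E), a set
X of rational primes of DIRICHLET DENSITY 0 (tree: `Literature.NumberTheory.LFunctions.HasDirichletDensity X 0`), and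
for EVERY prime ℓ' and EVERY embedding j : E → ℚ̄_{ℓ'} a SEMISIMPLE companion ρ'_j : Γ_{K₀} → GL_n(ℚ̄_{ℓ'}) reading
Q_v through j at v ∉ S, v ∤ ℓ', which for ℓ' ∉ X is crystalline at every v ∣ ℓ' with τ-labelled Hodge–Tate weights
H(σ) whenever τ|_{K₀} = j ∘ σ.  (Def. 6.1.1's clause (c) on det is omitted: a consequence of (a)+(b) by class field
theory, memo §2.)  Density 0 — not «all but finitely many» — is what makes ρ_{π,ι} of a RAC π over a CM field a member
in print (ACC+ Lemma 7.1.10) and is literally the hypothesis of BCGNT Thm 7.2.1 / Thm C. -/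
def InCompatibleSystem {K₀ : Type} [Field K₀] [NumberField K₀] {ℓ : ℕ} [Fact ℓ.Prime] {n : ℕ}
    (ρ₀ : FramedGaloisRep K₀ (PadicAlgCl ℓ) n) : Prop :=
  ∃ (E : Type) (_ : Field E) (_ : NumberField E) (e : E →+* PadicAlgCl ℓ) (S : Finset (HeightOneSpectrum (𝓞 K₀)))
    (Q : HeightOneSpectrum (𝓞 K₀) → Polynomial E) (H : (K₀ →+* E) → Multiset ℤ) (X : Set ℕ),
    (∀ τ₀ : K₀ →+* PadicAlgCl ℓ, ∃ σ : K₀ →+* E, e.comp σ = τ₀) ∧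
    Literature.NumberTheory.LFunctions.HasDirichletDensity X 0 ∧
    (∀ v : HeightOneSpectrum (𝓞 K₀), v ∉ S → ((ℓ : ℕ) : 𝓞 K₀) ∉ v.asIdeal →
        ρ₀.IsUnramifiedAt v ∧ ρ₀.HasFrobCharpolyAt v ((Q v).map e)) ∧
    ∀ (ℓ' : ℕ) [Fact ℓ'.Prime] (j : E →+* PadicAlgCl ℓ'), ∃ ρ' : FramedGaloisRep K₀ (PadicAlgCl ℓ') n,
      ρ'.toGaloisRep.IsSemisimple ∧
      (∀ v : HeightOneSpectrum (𝓞 K₀), v ∉ S → ((ℓ' : ℕ) : 𝓞 K₀) ∉ v.asIdeal →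
          ρ'.IsUnramifiedAt v ∧ ρ'.HasFrobCharpolyAt v ((Q v).map j)) ∧
      (ℓ' ∉ X → ∀ (v : HeightOneSpectrum (𝓞 K₀)) (hv : ((ℓ' : ℕ) : 𝓞 K₀) ∈ v.asIdeal),
          (fontainePstAdicCompletion v ℓ' hv).IsCrystallineFramed (ρ'.toLocal v) ∧
          ∀ (τ : v.adicCompletion K₀ →+* PadicAlgCl ℓ'), Continuous τ → ∀ σ : K₀ →+* E,
            j.comp σ = τ.comp (algebraMap K₀ (v.adicCompletion K₀)) → htAt ρ' v hv τ = H σ)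

/-- **`IsOfSystemType ρ`** — THE SECOND DIAL: the parent's TR/CM sandwich (UNP's clause `IsOfTRCMType`, verbatim) whose
core avatar ρ₀ over the totally real / CM field K₀ is, IN ADDITION, a member of a very weakly compatible system over K₀.
Two-sided on purpose: a property of the core (K₀, ρ₀), so orbit-closed under twist / solvable base change / solvable
descent exactly as the TR/CM clause (lens-1-g6 Lemma A/B; memo §3). -/
def IsOfSystemType {K : Type} [Field K] [NumberField K] {ℓ : ℕ} [Fact ℓ.Prime] {n : ℕ}
    (ρ : FramedGaloisRep K (PadicAlgCl ℓ) n) : Prop :=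
  ∃ (L : Type) (_ : Field L) (_ : NumberField L) (_ : Algebra K L),
    IsGalois K L ∧ IsSolvable (L ≃ₐ[K] L) ∧
    ∃ (K₀ : Type) (_ : Field K₀) (_ : NumberField K₀) (_ : Algebra K₀ L),
      IsGalois K₀ L ∧ IsSolvable (L ≃ₐ[K₀] L) ∧
      ∃ (ρ₀ : FramedGaloisRep K₀ (PadicAlgCl ℓ) n) (χ : FramedGaloisRep L (PadicAlgCl ℓ) 1),
        IsPinnedGeometric ρ₀ ∧ (NumberField.IsTotallyReal K₀ ∨ NumberField.IsCMField K₀) ∧ InCompatibleSystem ρ₀ ∧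
        ∀ g : Field.absoluteGaloisGroup L,
          FramedRep.trace (ρ.restrictField L) g = FramedRep.trace χ g * FramedRep.trace (ρ₀.restrictField L) g

/-- **The box of this node's target**: GNS's predicate «GW-box ∧ (¬ORD ∧ SYS)» (tree decl
`PolarisationCarving.GappedNonOrdinarySystemAutomorphy`, stmt-Langlands-33400; `Cert.gns_iff_box` is `Iff.rfl`). -/
def InAnordinarySystemBox {K : Type} [Field K] [NumberField K] {ℓ : ℕ} [Fact ℓ.Prime] {n : ℕ}
    (ρ : FramedGaloisRep K (PadicAlgCl ℓ) n) : Prop :=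
  InGappedBox ρ ∧ (¬ IsPotentiallyOrdinary ρ ∧ IsOfSystemType ρ)

/-! ## THE DIAL — OX: an irreducible, pinned-geometric, potentially ordinary E-rational mate of a core at SOME prime -/

/-- **`HasOrdinaryMate ρ₀`** (ρ₀ : Γ_{K₀} → GL_n(ℚ̄_ℓ)): there are a number field E with e : E → ℚ̄_ℓ, a finite set S of
places of K₀ and polynomials Q_v ∈ E[X] such that ρ₀ reads Q_v through e at every v ∉ S, v ∤ ℓ (E-RATIONAL FROBENIUS DATA),
and a prime ℓ′, an embedding j : E → ℚ̄_{ℓ′} and ρ′ : Γ_{K₀} → GL_n(ℚ̄_{ℓ′}) reading the SAME Q_v through j at v ∉ S,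
v ∤ ℓ′ (a MATE of ρ₀ inside its would-be compatible system) which is IRREDUCIBLE, PINNED-GEOMETRIC and POTENTIALLY
ORDINARY (the SlopeLadder clause `IsPotentiallyOrdinary`, at ℓ′ over K₀).  ℓ′ = ℓ is allowed by the typing but useless
for GNS members (ρ₀ is then not potentially ordinary, memo §3); ONE prime is asked, not infinitely many. -/
def HasOrdinaryMate {K₀ : Type} [Field K₀] [NumberField K₀] {ℓ : ℕ} [Fact ℓ.Prime] {n : ℕ}
    (ρ₀ : FramedGaloisRep K₀ (PadicAlgCl ℓ) n) : Prop :=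
  ∃ (E : Type) (_ : Field E) (_ : NumberField E) (e : E →+* PadicAlgCl ℓ) (S : Finset (HeightOneSpectrum (𝓞 K₀)))
    (Q : HeightOneSpectrum (𝓞 K₀) → Polynomial E),
    (∀ v : HeightOneSpectrum (𝓞 K₀), v ∉ S → ((ℓ : ℕ) : 𝓞 K₀) ∉ v.asIdeal → ρ₀.HasFrobCharpolyAt v ((Q v).map e)) ∧
    ∃ (ℓ' : ℕ) (_ : Fact ℓ'.Prime) (j : E →+* PadicAlgCl ℓ') (ρ' : FramedGaloisRep K₀ (PadicAlgCl ℓ') n),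
      (∀ v : HeightOneSpectrum (𝓞 K₀), v ∉ S → ((ℓ' : ℕ) : 𝓞 K₀) ∉ v.asIdeal → ρ'.HasFrobCharpolyAt v ((Q v).map j)) ∧
      ρ'.toGaloisRep.IsIrreducible ∧ IsPinnedGeometric ρ' ∧ IsPotentiallyOrdinary ρ'

/-- **`IsOrdinarySwitchable ρ`** — THE DIAL OX: the parent's TR/CM sandwich (`IsOfTRCMType`, clauses verbatim) whose core
ρ₀ over the totally real / CM field K₀, IN ADDITION, `HasOrdinaryMate`.  Two-sided on purpose: a property of the core
(K₀, ρ₀), hence orbit-closed under twist / solvable base change / solvable descent exactly as SAT and SYS (memo §3). -/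
def IsOrdinarySwitchable {K : Type} [Field K] [NumberField K] {ℓ : ℕ} [Fact ℓ.Prime] {n : ℕ}
    (ρ : FramedGaloisRep K (PadicAlgCl ℓ) n) : Prop :=
  ∃ (L : Type) (_ : Field L) (_ : NumberField L) (_ : Algebra K L),
    IsGalois K L ∧ IsSolvable (L ≃ₐ[K] L) ∧
    ∃ (K₀ : Type) (_ : Field K₀) (_ : NumberField K₀) (_ : Algebra K₀ L),
      IsGalois K₀ L ∧ IsSolvable (L ≃ₐ[K₀] L) ∧
      ∃ (ρ₀ : FramedGaloisRep K₀ (PadicAlgCl ℓ) n) (χ : FramedGaloisRep L (PadicAlgCl ℓ) 1),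
        IsPinnedGeometric ρ₀ ∧ (NumberField.IsTotallyReal K₀ ∨ NumberField.IsCMField K₀) ∧ HasOrdinaryMate ρ₀ ∧
        ∀ g : Field.absoluteGaloisGroup L,
          FramedRep.trace (ρ.restrictField L) g = FramedRep.trace χ g * FramedRep.trace (ρ₀.restrictField L) g


/-! ## Bridges: the born items of `PolarisationCarving` (tree, rev 6) ARE these boxes — `Iff.rfl` each -/

/-- UNP `PolarisationCarving.UnpolarisedTRCMTypeAutomorphy` (stmt-Langlands-32055) ↔ the box over `InUnpolarisedBox`. -/
theorem unp_iff_box :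
    PolarisationCarving.UnpolarisedTRCMTypeAutomorphy ↔
      PrimitiveAutomorphyWhere fun K _ _ ℓ _ n ρ => InUnpolarisedBox (K := K) (ℓ := ℓ) (n := n) ρ :=
  Iff.rfl

/-- POL `PolarisationCarving.PolarisedTypeAutomorphy` (stmt-Langlands-32056) ↔ the box over `IsOfPolarisedType`. -/
theorem pol_iff_box :
    PolarisationCarving.PolarisedTypeAutomorphy ↔
      PrimitiveAutomorphyWhere fun K _ _ ℓ _ n ρ => IsOfPolarisedType (K := K) (ℓ := ℓ) (n := n) ρ :=
  Iff.rfl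

/-- NTC `PolarisationCarving.NonTRCMTypeAutomorphy` (stmt-Langlands-32054) ↔ the box over `¬ IsOfTRCMType`. -/
theorem ntc_iff_box :
    PolarisationCarving.NonTRCMTypeAutomorphy ↔
      PrimitiveAutomorphyWhere fun K _ _ ℓ _ n ρ => ¬ IsOfTRCMType (K := K) (ℓ := ℓ) (n := n) ρ :=
  Iff.rfl

/-- CW `PolarisationCarving.ConsecutiveWeightAutomorphy` (stmt-Langlands-33398) ↔ UNP-box ∧ weight string. -/
theorem cw_iff_box :
    PolarisationCarving.ConsecutiveWeightAutomorphy ↔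
      PrimitiveAutomorphyWhere fun K _ _ ℓ _ n ρ =>
        InUnpolarisedBox (K := K) (ℓ := ℓ) (n := n) ρ ∧ HasWeightString (K := K) (ℓ := ℓ) (n := n) ρ :=
  Iff.rfl

/-- IW `PolarisationCarving.IrregularUnpolarisedAutomorphy` (stmt-Langlands-33402) ↔ UNP-box ∧ ¬regular. -/
theorem iw_iff_box :
    PolarisationCarving.IrregularUnpolarisedAutomorphy ↔
      PrimitiveAutomorphyWhere fun K _ _ ℓ _ n ρ =>
        InUnpolarisedBox (K := K) (ℓ := ℓ) (n := n) ρ ∧ ¬ IsHTRegular (K := K) (ℓ := ℓ) (n := n) ρ :=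
  Iff.rfl

/-- GWO `PolarisationCarving.GappedOrdinaryAutomorphy` (stmt-Langlands-33399) ↔ gapped box ∧ ORD. -/
theorem gwo_iff_box :
    PolarisationCarving.GappedOrdinaryAutomorphy ↔
      PrimitiveAutomorphyWhere fun K _ _ ℓ _ n ρ =>
        InGappedBox (K := K) (ℓ := ℓ) (n := n) ρ ∧ IsPotentiallyOrdinary (K := K) (ℓ := ℓ) (n := n) ρ :=
  Iff.rfl

/-- GNS `PolarisationCarving.GappedNonOrdinarySystemAutomorphy` (stmt-Langlands-33400) ↔ the box over `InAnordinarySystemBox`. -/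
theorem gns_iff_box :
    PolarisationCarving.GappedNonOrdinarySystemAutomorphy ↔
      PrimitiveAutomorphyWhere fun K _ _ ℓ _ n ρ => InAnordinarySystemBox (K := K) (ℓ := ℓ) (n := n) ρ :=
  Iff.rfl

/-- GNL `PolarisationCarving.GappedNonOrdinaryLoneAutomorphy` (stmt-Langlands-33401) ↔ gapped box ∧ ¬ORD ∧ ¬SYS. -/
theorem gnl_iff_box :
    PolarisationCarving.GappedNonOrdinaryLoneAutomorphy ↔
      PrimitiveAutomorphyWhere fun K _ _ ℓ _ n ρ =>
        InGappedBox (K := K) (ℓ := ℓ) (n := n) ρ ∧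
          (¬ IsPotentiallyOrdinary (K := K) (ℓ := ℓ) (n := n) ρ ∧ ¬ IsOfSystemType (K := K) (ℓ := ℓ) (n := n) ρ) :=
  Iff.rfl

end Summit.Langlands.Langlands.Theorems.PolarisationCarvingBoxes

end
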